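/-
HONEST FRAMING: certified error envelopes and provably optimal rounding/accumulation schemes for
low-precision formats under stated cost models; every table by two implementations; no hardware
or vendor claims.
-/
import Summits.Ventures.CertifiedArithmetic.LowPrec.OptDemotionMonoWClose

/-!
# The demotion law (Theorem T8), part 6j: the node step for BOTH-BELOW configurations (same binade)

HOME `CONJECTURE-D-NODESTEP.md` §G10.2 (ii): at a node `a·b` with computed value
`v = fl(v_a + v_b) ∈ [σ, 2σ)` and BOTH children in the binade just below (`σ/2 ≤ v_a, v_b < σ`), the
node deficit is covered by a line of `L_{a·b}` provided both children satisfy MONO (z-form,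
`MonoZTree`, part 6h) and W (`WTree`, part 6f): raise the lighter reading to the full-loss excess sum
`t = 2x + 2u`; `t ≥ 1`: `exchange_cover` + `below_close_exchange` (part 6i); `t < 1`:
`affine_endpoints` + `below_close_window`; the case "both children below `ξ = t - 1`" is excluded by the
grids of the two binades; `x = 0` by the μ-lines.  Together with part 6h's `node_line_spine` this
covers every configuration of the node step except the MIXED ones (`v_a ∈ [σ/2, σ)`, `v_b < σ/2`,
memo §G10.6).

* **`node_line_below`** — the float-level node step in CASE III-same-binade.
-/

namespace Summit.Ventures.CertifiedArithmetic.LowPrec.Opt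

open Literature.ComputerArithmetic.JeannerodRump2018
open Literature.ComputerArithmetic.JeannerodRump2018.SumTree
open Demotion

/-! ## The node step for both-below configurations (same binade) -/

section Node

variable {q : ℕ} {emin : ℤ} {fl : ℚ → ℚ}

/-- **THE NODE STEP, CASE III (both children in the binade below the root), FROM MONO AND W.**
`v = fl(v_a + v_b) ∈ [2^K, 2^(K+1))`, `2^(K-1) ≤ v_a, v_b < 2^K`; children's deficits below their
invariant lines; `MonoZTree` and `WTree` for both children.  Then a line of `L_{a·b}` covers the
node deficit at scale `2^K`. -/
theorem node_line_below (hq : 1 ≤ q) (hfl : IsRoundNearest q emin fl) {a b : SumTree}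
    {va vb da db : ℚ} (ha : IsFloat q emin va) (hb : IsFloat q emin vb)
    {la lb : ℚ × ℚ} (hla : la ∈ allLines (unitRoundoff q) a)
    (hlb : lb ∈ allLines (unitRoundoff q) b)
    (hda : 0 < va → da ≤ (2 : ℚ) ^ (Int.log 2 va) * (la.1 - la.2) + la.2 * va)
    (hdb : 0 < vb → db ≤ (2 : ℚ) ^ (Int.log 2 vb) * (lb.1 - lb.2) + lb.2 * vb)
    (hMa : MonoZTree q a) (hMb : MonoZTree q b) (hWa : WTree q a) (hWb : WTree q b)
    {K : ℤ} (hvlo : (2 : ℚ) ^ K ≤ fl (va + vb)) (hvhi : fl (va + vb) < (2 : ℚ) ^ (K + 1))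
    (haK : (2 : ℚ) ^ (K - 1) ≤ va) (haK' : va < (2 : ℚ) ^ K)
    (hbK : (2 : ℚ) ^ (K - 1) ≤ vb) (hbK' : vb < (2 : ℚ) ^ K) :
    ∃ l ∈ allLines (unitRoundoff q) (.node a b),
      da + db + (va + vb - fl (va + vb)) ≤ (2 : ℚ) ^ K * (l.1 - l.2) + l.2 * fl (va + vb) := by
  set u := unitRoundoff q with hudef
  have h2 : (2 : ℚ) ≠ 0 := by norm_num
  obtain ⟨τ, hτdef⟩ : ∃ τ : ℚ, τ = (2 : ℚ) ^ (K - 1) := ⟨_, rfl⟩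
  obtain ⟨σ, hσdef⟩ : ∃ σ : ℚ, σ = (2 : ℚ) ^ K := ⟨_, rfl⟩
  have hστ : σ = 2 * τ := by
    rw [hσdef, hτdef, show K = K - 1 + 1 by ring, zpow_add_one₀ h2, show K - 1 + 1 - 1 = K - 1 by ring]
    ring
  have hτpos : 0 < τ := by rw [hτdef]; exact zpow_pos (by norm_num) _
  have hσpos : 0 < σ := by rw [hστ]; linarith
  rw [← hτdef] at haK hbK
  have hvapos : 0 < va := lt_of_lt_of_le hτpos haK
  have hvbpos : 0 < vb := lt_of_lt_of_le hτpos hbK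
  have hvF : IsFloat q emin (fl (va + vb)) := (hfl _).1
  obtain ⟨habs, -⟩ := round_sum_facts hq hfl ha hb hvapos.le hvbpos.le hvhi
  have hxtop0 := isFloat_le_top hvF (lt_of_lt_of_le (zpow_pos (by norm_num) _) hvlo) hvhi
  obtain ⟨v, hvdef⟩ : ∃ v : ℚ, v = fl (va + vb) := ⟨_, rfl⟩
  rw [← hvdef] at hvlo hvhi habs hvF hxtop0 ⊢
  rw [← hσdef] at hvlo haK' hbK' habs ⊢
  have hu0 : 0 ≤ u := unitRoundoff_nonneg q
  have hupos : 0 < u := by rw [hudef]; unfold unitRoundoff; positivity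
  have hu1 : u ≤ 1 := unitRoundoff_le_one q
  have hu2 : u ≤ 1 / 2 := unitRoundoff_le_half hq
  have hug : u * σ = (2 : ℚ) ^ (K - q) := by rw [hσdef]; exact (u_mul_zpow q K).1
  have hug2 : 2 * u * σ = (2 : ℚ) ^ (K + 1 - q) := by rw [hσdef]; exact (u_mul_zpow q K).2
  have hvpos : 0 < v := lt_of_lt_of_le hσpos hvlo
  have hsumhi : va + vb ≤ v + u * σ := by have := (abs_le.mp habs).2; linarith
  have hsumlo : v - u * σ ≤ va + vb := by have := (abs_le.mp habs).1; linarith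
  -- lines
  obtain ⟨hla2, hla2M, hla1, hla1M⟩ := allLines_bounds hu0 hu1 a la hla
  obtain ⟨hlb2, hlb2M, hlb1, hlb1M⟩ := allLines_bounds hu0 hu1 b lb hlb
  -- children's deficits at scale τ
  have hloga : Int.log 2 va = K - 1 :=
    int_log_eq_of_mem hvapos (by rw [← hτdef]; exact haK)
      (by rw [show K - 1 + 1 = K by ring, ← hσdef]; exact haK')
  have hlogb : Int.log 2 vb = K - 1 :=
    int_log_eq_of_mem hvbpos (by rw [← hτdef]; exact hbK)
      (by rw [show K - 1 + 1 = K by ring, ← hσdef]; exact hbK')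
  obtain ⟨xa, hxa⟩ : ∃ xa : ℚ, xa = va / τ - 1 := ⟨_, rfl⟩
  obtain ⟨xb, hxb⟩ : ∃ xb : ℚ, xb = vb / τ - 1 := ⟨_, rfl⟩
  have hvaτ : va = τ * (1 + xa) := by rw [hxa]; field_simp; ring
  have hvbτ : vb = τ * (1 + xb) := by rw [hxb]; field_simp; ring
  have hxa0 : 0 ≤ xa := by
    rw [hxa, sub_nonneg, le_div_iff₀ hτpos]; linarith
  have hxb0 : 0 ≤ xb := by
    rw [hxb, sub_nonneg, le_div_iff₀ hτpos]; linarith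
  have hxa1 : xa ≤ 1 := by
    have : τ * xa ≤ τ * 1 := by linarith [hvaτ, haK', hστ]
    exact le_of_mul_le_mul_left this hτpos
  have hxb1 : xb ≤ 1 := by
    have : τ * xb ≤ τ * 1 := by linarith [hvbτ, hbK', hστ]
    exact le_of_mul_le_mul_left this hτpos
  have hda' : da ≤ τ * (la.1 + la.2 * xa) := by
    have h := hda hvapos; rw [hloga, ← hτdef] at h
    have e : τ * (la.1 - la.2) + la.2 * va = τ * (la.1 + la.2 * xa) := by rw [hvaτ]; ring
    linarith
  have hdb' : db ≤ τ * (lb.1 + lb.2 * xb) := by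
    have h := hdb hvbpos; rw [hlogb, ← hτdef] at h
    have e : τ * (lb.1 - lb.2) + lb.2 * vb = τ * (lb.1 + lb.2 * xb) := by rw [hvbτ]; ring
    linarith
  -- the root excess x = 2ju
  obtain ⟨N, hN⟩ := isFloat_grid hvF (K := K) (by rw [← hσdef]; exact hvlo)
  rw [← hug2] at hN
  obtain ⟨x, hx⟩ : ∃ x : ℚ, x = v / σ - 1 := ⟨_, rfl⟩
  have hvx : v = σ * (1 + x) := by rw [hx]; field_simp; ring
  have hx0 : 0 ≤ x := by rw [hx, sub_nonneg, le_div_iff₀ hσpos]; linarith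
  have hpow : (2 : ℚ) ^ q = 2 * 2 ^ (q - 1) := by
    conv_lhs => rw [← Nat.sub_add_cancel hq, pow_succ]
    ring
  have hu2q : u * (2 : ℚ) ^ (q - 1) = 1 / 2 := by
    rw [hudef]; unfold unitRoundoff; rw [hpow]; field_simp
  -- σ = 2^(q-1) · (2uσ), so N ≥ 2^(q-1)
  have hσg : σ = (2 : ℚ) ^ (q - 1) * (2 * u * σ) := by
    have : (2 : ℚ) ^ (q - 1) * (2 * u * σ) = 2 * (u * (2 : ℚ) ^ (q - 1)) * σ := by ring
    rw [this, hu2q]; ring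
  have huσ2 : 0 < 2 * u * σ := by positivity
  have hNge : (2 : ℤ) ^ (q - 1) ≤ N := by
    have h1 : (2 : ℚ) ^ (q - 1) * (2 * u * σ) ≤ (N : ℚ) * (2 * u * σ) := by rw [← hσg, ← hN]; exact hvlo
    have h3 := le_of_mul_le_mul_right h1 huσ2
    exact_mod_cast h3
  obtain ⟨j, hj⟩ : ∃ j : ℕ, ((j : ℤ) = N - 2 ^ (q - 1)) := ⟨(N - 2 ^ (q - 1)).toNat, by omega⟩
  have hjq : (j : ℚ) = (N : ℚ) - (2 : ℚ) ^ (q - 1) := by exact_mod_cast hj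
  have hxj : x = 2 * (j : ℚ) * u := by
    have e1 : σ * x = v - σ := by rw [hvx]; ring
    have e2 : v - σ = (j : ℚ) * (2 * u * σ) := by rw [hjq, hN]; nth_rewrite 2 [hσg]; ring
    have e3 : σ * x = σ * (2 * (j : ℚ) * u) := by rw [e1, e2]; ring
    exact mul_left_cancel₀ (ne_of_gt hσpos) e3
  -- x ≤ 1 - 2u, hence j < 2^(q-1)
  have hxtop : v ≤ 2 * σ - 2 * u * σ := by
    have h1 := hxtop0
    rw [zpow_add_one₀ h2, ← (u_mul_zpow q K).2, ← hσdef] at h1; linarith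
  have hjlt : j < 2 ^ (q - 1) := by
    have h1 : σ * x ≤ σ * (1 - 2 * u) := by rw [hvx] at hxtop; linarith
    have h3 : x ≤ 1 - 2 * u := le_of_mul_le_mul_left h1 hσpos
    have h4 : 2 * (j : ℚ) * u ≤ 1 - 2 * u := by rw [← hxj]; exact h3
    have h5 : (j : ℚ) < 2 ^ (q - 1) := by
      have h6 : ((j : ℚ) + 1) * (2 * (u * (2 : ℚ) ^ (q - 1))) ≤ 1 * (2 : ℚ) ^ (q - 1) := by
        have : ((j : ℚ) + 1) * (2 * u) ≤ 1 := by linarith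
        have := mul_le_mul_of_nonneg_right this (by positivity : (0 : ℚ) ≤ (2 : ℚ) ^ (q - 1))
        linarith [this]
      rw [hu2q] at h6; linarith
    exact_mod_cast h5
  have hjlt2 : j < 2 ^ q := lt_of_lt_of_le hjlt (Nat.pow_le_pow_right (by norm_num) (by omega))
  -- the excess budget t = 2x + 2u and the loss r
  have ht_ge : xa + xb ≤ 2 * x + 2 * u := by
    have h1 : τ * (2 + xa + xb) ≤ τ * (2 + 2 * x + 2 * u) := by
      rw [hvaτ, hvbτ, hvx, hστ] at hsumhi; linarith
    linarith [le_of_mul_le_mul_left h1 hτpos]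
  have hr : va + vb - v ≤ u * σ := by linarith
  have hT0 : da + db + (va + vb - v) ≤ τ * (la.1 + la.2 * xa) + τ * (lb.1 + lb.2 * xb) + (va + vb - v) := by
    linarith
  -- CASE x = 0 (j = 0): the μ-lines cover
  rcases Nat.eq_zero_or_pos j with hj0 | hjpos
  · have hx00 : x = 0 := by rw [hxj, hj0]; simp
    have hsmall : xa + xb ≤ 2 * u := by rw [hx00] at ht_ge; linarith
    have hrr : va + vb - v = τ * (xa + xb) := by rw [hvaτ, hvbτ, hvx, hx00, hστ]; ring
    have hM1 : 1 ≤ treeM u a := one_le_treeM hu0 a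
    have hM2 : 1 ≤ treeM u b := one_le_treeM hu0 b
    -- τ(la.1 + la.2 xa) ≤ τ(μ_a + μ_a xa), etc.
    have p1 := mul_le_mul_of_nonneg_right hla2M hxa0
    have p2 := mul_le_mul_of_nonneg_right hlb2M hxb0
    have e1 : la.1 + la.2 * xa ≤ (treeM u a - 1) * (1 + xa) := by linarith
    have e2 : lb.1 + lb.2 * xb ≤ (treeM u b - 1) * (1 + xb) := by linarith
    have hμa0 : 0 ≤ treeM u a - 1 := by linarith
    have hμb0 : 0 ≤ treeM u b - 1 := by linarith
    have h12u : 0 ≤ 1 - 2 * u := by linarith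
    have k1 := mul_le_mul_of_nonneg_left e1 hτpos.le
    have k2 := mul_le_mul_of_nonneg_left e2 hτpos.le
    rcases le_total (treeM u b) (treeM u a) with hM | hM
    · refine ⟨_, mem_allLines_F1 (b := b) (mu_mem_allLines hu0 hu1 a), ?_⟩
      dsimp only
      rw [hvx, hx00]
      -- μ_b x_b ≤ μ_a x_b ; μ_a (x_a + x_b) ≤ 2u μ_a ; (μ_a - μ_b)(1 - 2u) ≥ 0
      have p3 := mul_le_mul_of_nonneg_right (sub_le_sub_right hM 1) hxb0
      have p4 := mul_le_mul_of_nonneg_left hsmall hμa0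
      have p5 := mul_nonneg (sub_nonneg.2 (sub_le_sub_right hM 1)) h12u
      have goalτ : (treeM u a - 1) * (1 + xa) + (treeM u b - 1) * (1 + xb) + (xa + xb)
          ≤ 2 * ((treeM u a - 1) + u + u * (treeM u b - 1)) := by linarith
      have := mul_le_mul_of_nonneg_left goalτ hτpos.le
      rw [hx00] at hvx
      rw [hvx] at hrr
      rw [hστ] at hrr ⊢
      linarith
    · refine ⟨_, mem_allLines_F2 (a := a) (mu_mem_allLines hu0 hu1 b), ?_⟩
      dsimp only
      rw [hvx, hx00]
      have p3 := mul_le_mul_of_nonneg_right (sub_le_sub_right hM 1) hxa0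
      have p4 := mul_le_mul_of_nonneg_left hsmall hμb0
      have p5 := mul_nonneg (sub_nonneg.2 (sub_le_sub_right hM 1)) h12u
      have goalτ : (treeM u a - 1) * (1 + xa) + (treeM u b - 1) * (1 + xb) + (xa + xb)
          ≤ 2 * ((treeM u b - 1) + u + u * (treeM u a - 1)) := by linarith
      have := mul_le_mul_of_nonneg_left goalτ hτpos.le
      rw [hx00] at hvx
      rw [hvx] at hrr
      rw [hστ] at hrr ⊢
      linarith
  · have hj1 : 1 ≤ j := hjpos
    -- budget t
    obtain ⟨t, htdef⟩ : ∃ t : ℚ, t = 2 * x + 2 * u := ⟨_, rfl⟩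
    rw [← htdef] at ht_ge
    rcases le_or_gt 1 t with ht1 | ht1
    · -- (A) t ≥ 1: exchange
      obtain ⟨ξ, hξdef⟩ : ∃ ξ : ℚ, ξ = t - 1 := ⟨_, rfl⟩
      have hξ0 : 0 ≤ ξ := by rw [hξdef]; linarith
      have hξrel : τ * (1 + ξ) = σ * (x + u) := by rw [hξdef, htdef, hστ]; ring
      -- choose which child to raise
      have hraise : ∃ xa' xb' : ℚ, xa ≤ xa' ∧ xa' ≤ 1 ∧ xb ≤ xb' ∧ xb' ≤ 1 ∧ xa' + xb' = 1 + ξ := by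
        by_cases hA : ξ ≤ xa
        · exact ⟨xa, t - xa, le_rfl, hxa1, by linarith, by rw [hξdef] at hA; linarith, by rw [hξdef]; ring⟩
        · by_cases hB : ξ ≤ xb
          · exact ⟨t - xb, xb, by linarith, by rw [hξdef] at hB; linarith, le_rfl, hxb1, by rw [hξdef]; ring⟩
          · -- both below ξ: impossible (grid argument)
            exfalso
            push Not at hA hB
            -- va, vb < τ(1+ξ) = σ(x+u) = v + uσ - σ
            have q1 := mul_lt_mul_of_pos_left hA hτpos
            have q2 := mul_lt_mul_of_pos_left hB hτpos
            have h1 : va < v + u * σ - σ := by rw [hvaτ, hvx]; linarith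
            have h1b : vb < v + u * σ - σ := by rw [hvbτ, hvx]; linarith
            -- hence v > 2σ - 3uσ, so v = 2σ - 2uσ (grid 2uσ)
            have h3 : 2 * σ - 3 * (u * σ) < v := by linarith
            have hσN : 2 * σ - 2 * u * σ = (((2 : ℤ) ^ q - 1 : ℤ) : ℚ) * (2 * u * σ) := by
              push_cast; rw [hpow]; nth_rewrite 1 [hσg]; ring
            have h4 : 2 * σ - 2 * u * σ ≤ v :=
              grid_le_of_lt huσ2 hσN hN (by linarith)
            have hveq : v = 2 * σ - 2 * u * σ := le_antisymm hxtop h4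
            -- va, vb < σ - uσ ⇒ va, vb ≤ σ - 2uσ (grid uσ of the lower binade)
            obtain ⟨Na, hNa⟩ := isFloat_grid ha (by rw [← hτdef]; exact haK)
            obtain ⟨Nb, hNb⟩ := isFloat_grid hb (by rw [← hτdef]; exact hbK)
            have hgτ : (2 : ℚ) ^ (K - 1 + 1 - q) = u * σ := by rw [show K - 1 + 1 - q = K - q by ring, hug]
            rw [hgτ] at hNa hNb
            have huσ : 0 < u * σ := by positivity
            have hσN2 : σ - 2 * (u * σ) = (((2 : ℤ) ^ q - 2 : ℤ) : ℚ) * (u * σ) := by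
              push_cast; rw [hpow]; nth_rewrite 1 [hσg]; ring
            have h5 : va ≤ σ - 2 * (u * σ) := grid_le_of_lt huσ hNa hσN2 (by linarith)
            have h6 : vb ≤ σ - 2 * (u * σ) := grid_le_of_lt huσ hNb hσN2 (by linarith)
            linarith
      obtain ⟨xa', xb', hxaa, hxa'1, hxbb, hxb'1, hsum'⟩ := hraise
      have qa := mul_le_mul_of_nonneg_left (mul_le_mul_of_nonneg_left hxaa hla2) hτpos.le
      have qb := mul_le_mul_of_nonneg_left (mul_le_mul_of_nonneg_left hxbb hlb2) hτpos.le
      have hda2 : da ≤ τ * (la.1 + la.2 * xa') := by linarith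
      have hdb2 : db ≤ τ * (lb.1 + lb.2 * xb') := by linarith
      have hex := exchange_cover hu0 hu1 a b hxa'1 hxb'1 hξ0 hsum' hla hlb
      rcases le_max_iff.mp hex with h1 | h1
      · -- a credited at the root scale, b squeezed: F3 via MONO(b)
        have hT : da + db + (va + vb - v)
            ≤ σ * (treeM u a - 1) + τ * (lb.1 + lb.2 * ξ) + (va + vb - v) := by
          have := mul_le_mul_of_nonneg_left h1 hτpos.le
          rw [hστ]; linarith
        obtain ⟨l, hl, hle⟩ := below_close_exchange hq a b hστ hτpos hj1 hjlt hxj hξrel hξ0 hlb hMb hr hT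
        exact ⟨l, hl, by rw [← hvx] at hle; exact hle⟩
      · have hT : da + db + (va + vb - v)
            ≤ σ * (treeM u b - 1) + τ * (la.1 + la.2 * ξ) + (va + vb - v) := by
          have := mul_le_mul_of_nonneg_left h1 hτpos.le
          rw [hστ]; linarith
        obtain ⟨l, hl, hle⟩ := below_close_exchange hq b a hστ hτpos hj1 hjlt hxj hξrel hξ0 hla hMa hr hT
        exact ⟨l, allLines_swap hl, by rw [← hvx] at hle; exact hle⟩
    · -- (B) t < 1: affine endpoints + window
      have ht1' : 2 * x + 2 * u < 1 := by rw [← htdef]; exact ht1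
      have hxb'0 : 0 ≤ t - xa := by linarith
      have qb := mul_le_mul_of_nonneg_left
        (mul_le_mul_of_nonneg_left (by linarith : xb ≤ t - xa) hlb2) hτpos.le
      have hdb2 : db ≤ τ * (lb.1 + lb.2 * (t - xa)) := by linarith
      have haff := affine_endpoints hxa0 hxb'0 la lb
      have hsum' : xa + (t - xa) = t := by ring
      rw [hsum'] at haff
      rcases le_max_iff.mp haff with h1 | h1
      · have hT : da + db + (va + vb - v)
            ≤ τ * (la.1 + la.2 * (2 * x + 2 * u)) + τ * (treeM u b - 1) + (va + vb - v) := by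
          have := mul_le_mul_of_nonneg_left h1 hτpos.le
          have k := mul_le_mul_of_nonneg_left hlb1M hτpos.le
          rw [← htdef]; linarith
        obtain ⟨l, hl, hle⟩ := below_close_window hq a b hστ hτpos hjlt2 hxj ht1' hla hMa hWa hr hT
        exact ⟨l, hl, by rw [← hvx] at hle; exact hle⟩
      · have hT : da + db + (va + vb - v)
            ≤ τ * (lb.1 + lb.2 * (2 * x + 2 * u)) + τ * (treeM u a - 1) + (va + vb - v) := by
          have := mul_le_mul_of_nonneg_left h1 hτpos.le
          have k := mul_le_mul_of_nonneg_left hla1M hτpos.le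
          rw [← htdef]; linarith
        obtain ⟨l, hl, hle⟩ := below_close_window hq b a hστ hτpos hjlt2 hxj ht1' hlb hMb hWb hr hT
        exact ⟨l, allLines_swap hl, by rw [← hvx] at hle; exact hle⟩

end Node

end Summit.Ventures.CertifiedArithmetic.LowPrec.Opt
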